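import Summits.CriticalPhenomena.CardyFormulaZ2.Theorems.CardyComplexConeParafermionToSLESixFamiliesFlipDefs
import Summits.CriticalPhenomena.CardyFormulaZ2.Theorems.CardyComplexConeParafermionToSLESixFamiliesIicRectilinear
import Summits.CriticalPhenomena.CardyFormulaZ2.Theorems.CardySusyWardDiscretisationFamilyExists
import HarnessLib

/-!
# Stub `stub_allDomainsOfDiag` of line `flip-involution-return-law` (crux `ParafermionToSLESixFamilies`, stmt-CriticalPhenomena-11389): the diagonal sandwich (PIECE 2, proved), non-vacuity, and the reduction to the two missing pieces

Route `CardyComplexCone` (sub-problem `CriticalPhenomena/CardyFormulaZ2`), crux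
`Summit.CriticalPhenomena.CardyFormulaZ2.Theses.CardyComplexCone.ParafermionToSLESixFamilies`, line
`flip-involution-return-law` (skeleton `Cruxes/ParafermionToSLESixFamilies/Lines/flip_involution_return_law.lean`,
vocabulary `Theorems/CardyComplexConeParafermionToSLESixFamiliesFlipDefs.lean`). The registered stub reads

  `(∀ D, IsDiagRectilinear D → ∀ Λ, IsFamily D Λ → SLESixAlong D Λ) → SLESixAllFamilies`

(SLE₆ along every admissible family of every ALL-DIAGONAL Dobrushin polygon ⇒ block C of the crux: SLE₆ for every
Jordan Dobrushin domain along every admissible family; the diagonal twin of stub S7 `stub_allDomainsOfRectilinear`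
of the dead line `iic-trace-flux-pairing`, audited in `…IicRectilinear.lean`). Its card lists three pieces:
(1) SLE₆ on diagonal polygons ⇒ Cardy's crossing limit for diagonal-polygonal conformal rectangles; (2) a DIAGONAL
twin of the tree's proved `RectilinearSuffices_proof` (Bollobás–Riordan sandwich) ⇒ `CardyFormulaZ2`; (3) the
Camia–Newman transfer on bond-`ℤ²` (Cardy in all conformal rectangles ⇒ identification of subsequential interface
laws as chordal SLE₆ on all Jordan domains), then the landed `slesixAllFamilies_of_identAllFamilies`. Pieces (1)
and (3) are research-sized and absent from the tree (no `def … : Prop` states either); block C is, up to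
unbundling, the OPEN conjecture `SLE6LimitZ2AllDiscretisations`. This file does NOT prove the stub. It records,
sorry-free and without defining any proposition:

* §1 **the tilt `z ↦ (1+i)z`** turns axis-parallel data into all-diagonal data (`tilt_pair_diag`,
  `image_tilt_biUnion_segment`, `isDiagRectilinear_map_tilt`), all-diagonal Dobrushin polygons exist
  (`exists_isDiagRectilinear`, the tilted marked square), EVERY Dobrushin domain carries an admissible family
  (`exists_isFamily`: the route's construction item `DiscretisationFamilyExists`, stmt-9644, is PROVED in the tree,
  `DiscretisationFamilyExists_proof`), hence **the hypothesis class of the stub is inhabited unconditionally**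
  (`exists_isDiagRectilinear_and_isFamily`): the antecedent is a genuine instance of the SLE₆ conjecture, no
  ex falso;
* §2 **diagonal approximation** (`exists_diag_close`): every conformal rectangle has, for every `ε > 0`, a
  conformal rectangle with the same marks, frontier inside finitely many segments of slope `±1`, and boundary loop
  uniformly `ε`-close — the tilt-conjugate of the tree's rectilinear approximation `exists_rectilinear_close`;
* §3 **PIECE 2, PROVED** (`cardyFormulaZ2_of_diagCardy`): Cardy's formula for bond-`ℤ²` in every conformal
  rectangle whose frontier lies in finitely many slope-`±1` segments implies `CardyFormulaZ2` — the
  Bollobás–Riordan construction-free sandwich of `RectilinearApproximation.cardyFormulaZ2_of_rectilinearCardy`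
  re-run with diagonal approximants (its deterministic inclusions and self-duality bound are shape-blind); with
  the trivial converse, `diagCardy_iff_cardyFormulaZ2`;
* §4 **the reduction** (`allDomainsOfDiag_of`, registered): the stub follows from PIECE 1 (typed: diagonal SLE₆ ⇒
  diagonal Cardy, covering form as in `RectilinearCardy`) and PIECE 3 (typed: `CardyFormulaZ2` ⇒ identification
  on all Jordan domains along all admissible families), glued through the PROVED §3 and the landed
  `slesixAllFamilies_of_identAllFamilies`; and PIECES 1 + 2 alone already give the ROUTE's target
  `CardyFormulaZ2` (`cardyFormulaZ2_of_diag_of`). Both pieces appear only as HYPOTHESES, spelled out in full.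

Sources: B. Bollobás, O. Riordan, *Percolation* (CUP 2006), Ch. 7 (Lemma 14, Claims 19–20, remark p. 195);
S. Smirnov, C. R. Acad. Sci. Paris 333 (2001) §2; F. Camia, C. M. Newman, Probab. Theory Relat. Fields 139
(2007), Thms 2–5, §§5–7; W. Werner, *Lectures on two-dimensional critical percolation* (2007), Lecture 3.
-/

noncomputable section

open scoped Topology NNReal ENNReal BigOperators Classical
open Filter Set MeasureTheory Metric
open Literature.Probability Literature.Probability.LatticeModels Literature.Probability.Percolation
open Literature.Probability.RandomPlanarGeometry
open Summit.CriticalPhenomena.CardyFormulaZ2.Cruxes.ParafermionToSLESixFamilies.IicTraceFluxPairing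
open Summit.CriticalPhenomena.CardyFormulaZ2.Cruxes.LoopsToCrossings.OracleSandwich
  (stub_discreteCrossing_of_pathIn stub_not_discreteCrossing_of_dualPathIn stub_cardyContinuity
    stub_comparisonGeometry stub_cyclicFlip)
open Summit.CriticalPhenomena.CardyFormulaZ2.Theorems (exists_rectilinear_close)
open Summit.CriticalPhenomena.CardyFormulaZ2.Theorems.RectilinearApproximation
  (discreteCrossing_subset_of_lower discreteCrossing_subset_plate bond_le_one_sub_real_openCrossing)

namespace Summit.CriticalPhenomena.CardyFormulaZ2.Cruxes.ParafermionToSLESixFamilies.FlipInvolutionReturnLaw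

/-! ## §1 The tilt `z ↦ (1 + i) z`: axis-parallel data become all-diagonal data -/

/-- `1 + i ≠ 0`. -/
theorem one_add_I_ne_zero : (1 + Complex.I : ℂ) ≠ 0 := by
  intro h
  have := congrArg Complex.re h
  simp at this

/-- Multiplication by a constant maps segments to segments. -/
theorem image_mul_segment (c a b : ℂ) :
    (fun z : ℂ => c * z) '' segment ℝ a b = segment ℝ (c * a) (c * b) := by
  have h := image_segment ℝ (LinearMap.mul ℝ ℂ c).toAffineMap a b
  simpa using h

/-- The tilt of an axis-parallel pair of points (equal abscissae or equal ordinates) is a diagonal pair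
(difference of slope `±1`). -/
theorem tilt_pair_diag {a b : ℂ} (h : a.re = b.re ∨ a.im = b.im) :
    ((1 + Complex.I) * a - (1 + Complex.I) * b).re = ((1 + Complex.I) * a - (1 + Complex.I) * b).im ∨
      ((1 + Complex.I) * a - (1 + Complex.I) * b).re = -((1 + Complex.I) * a - (1 + Complex.I) * b).im := by
  rcases h with h | h
  · right
    have h' : (a - b).re = 0 := by rw [Complex.sub_re, h, sub_self]
    simp only [← mul_sub, Complex.mul_re, Complex.mul_im, Complex.add_re, Complex.one_re, Complex.I_re,
      Complex.add_im, Complex.one_im, Complex.I_im, h']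
    ring
  · left
    have h' : (a - b).im = 0 := by rw [Complex.sub_im, h, sub_self]
    simp only [← mul_sub, Complex.mul_re, Complex.mul_im, Complex.add_re, Complex.one_re, Complex.I_re,
      Complex.add_im, Complex.one_im, Complex.I_im, h']
    ring

/-- The tilt of a union of segments indexed by a finite set of endpoint pairs is the union of the tilted
segments, indexed by the tilted pairs. -/
theorem image_tilt_biUnion_segment (S : Finset (ℂ × ℂ)) :
    (Homeomorph.mulLeft₀ (1 + Complex.I) one_add_I_ne_zero) '' (⋃ e ∈ S, segment ℝ e.1 e.2) =
      ⋃ e ∈ S.image (fun e => ((1 + Complex.I) * e.1, (1 + Complex.I) * e.2)), segment ℝ e.1 e.2 := by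
  rw [Set.image_iUnion₂, Finset.set_biUnion_finset_image]
  refine Set.iUnion₂_congr fun e _ => ?_
  rw [Homeomorph.coe_mulLeft₀]
  exact image_mul_segment _ _ _

/-- The tilt stretches distances by at most `2` (in fact by `√2`). -/
theorem dist_tilt_le (a b : ℂ) : dist ((1 + Complex.I) * a) ((1 + Complex.I) * b) ≤ 2 * dist a b := by
  rw [dist_eq_norm, dist_eq_norm, ← mul_sub, norm_mul]
  gcongr
  calc ‖(1 + Complex.I : ℂ)‖ ≤ ‖(1 : ℂ)‖ + ‖Complex.I‖ := norm_add_le _ _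
    _ = 2 := by rw [norm_one, Complex.norm_I]; norm_num

/-- **The tilt of a rectilinear Dobrushin polygon is an all-diagonal polygon** (`MarkedDomain.map`: same
boundary parameters, transported loop; sides of slope `0`/`∞` become sides of slope `±1`). -/
theorem isDiagRectilinear_map_tilt (D : DobrushinDomain) (hD : IsRectilinear D) :
    IsDiagRectilinear (D.map (Homeomorph.mulLeft₀ (1 + Complex.I) one_add_I_ne_zero)) := by
  classical
  obtain ⟨S, hS, hfr⟩ := hD
  refine ⟨S.image (fun e => ((1 + Complex.I) * e.1, (1 + Complex.I) * e.2)), ?_, ?_⟩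
  · intro e he
    obtain ⟨e₀, he₀, rfl⟩ := Finset.mem_image.1 he
    refine tilt_pair_diag ?_
    rcases hS e₀ he₀ with h | h
    · left; rw [Complex.sub_re] at h; linarith
    · right; rw [Complex.sub_im] at h; linarith
  · rw [MarkedDomain.carrier_map, ← Homeomorph.image_frontier, hfr]
    exact image_tilt_biUnion_segment S

/-- **All-diagonal Dobrushin polygons exist** (the tilted marked square), so the `∀ D, IsDiagRectilinear D → …`
statements of the line are not vacuous. -/
theorem exists_isDiagRectilinear : ∃ D : DobrushinDomain, IsDiagRectilinear D := by
  obtain ⟨D, hD⟩ := exists_isRectilinear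
  exact ⟨_, isDiagRectilinear_map_tilt D hD⟩

/-- Every Dobrushin domain carries an admissible discretisation family: the route's construction item
`DiscretisationFamilyExists` (stmt-CriticalPhenomena-9644) is PROVED in the tree
(`DiscretisationFamilyExists_proof`, shared declaration of route `CardySusyWard`), and its conjuncts are the
six fields of `IsFamily`. -/
theorem exists_isFamily (D : DobrushinDomain) : ∃ Λ : ℝ → DiscreteDobrushin, IsFamily D Λ := by
  obtain ⟨Λ, h1, h2, h3, h4, h5, h6⟩ :=
    Summit.CriticalPhenomena.CardyFormulaZ2.Theorems.DiscretisationFamilyExists_proof D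
  exact ⟨Λ, h1, h2, h3, h4, h5, h6⟩

/-- **The hypothesis class of `stub_allDomainsOfDiag` is inhabited** (unconditionally): an all-diagonal
Dobrushin polygon together with an admissible discretisation family of it. Hence the antecedent
`∀ D, IsDiagRectilinear D → ∀ Λ, IsFamily D Λ → SLESixAlong D Λ` is a genuine instance of the SLE₆ conjecture
on `ℤ²`, not vacuously true, and the stub is not block C in disguise. -/
theorem exists_isDiagRectilinear_and_isFamily :
    ∃ (D : DobrushinDomain) (Λ : ℝ → DiscreteDobrushin), IsDiagRectilinear D ∧ IsFamily D Λ := by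
  obtain ⟨D, hD⟩ := exists_isDiagRectilinear
  obtain ⟨Λ, hΛ⟩ := exists_isFamily D
  exact ⟨D, Λ, hD, hΛ⟩

/-! ## §2 Diagonal Jordan polygons uniformly close to a given conformal rectangle -/

/-- **Diagonal approximation of conformal rectangles.** Every conformal rectangle `D` admits, for every
`ε > 0`, a conformal rectangle `P` with the same marks whose frontier lies in finitely many segments of
slope `±1` and whose boundary loop is uniformly `ε`-close to that of `D`: tilt back `D` by `(1+i)⁻¹`,
take the rectilinear lattice-polygon approximant at `ε/2` (`exists_rectilinear_close`, the
Bollobás–Riordan shadow/loop-erasure construction of route `CardyBoundaryCoulombGas`), and tilt it forward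
(distances grow by `|1+i| ≤ 2`). -/
theorem exists_diag_close (D : ConformalRectangle) {ε : ℝ} (hε : 0 < ε) :
    ∃ P : ConformalRectangle, (∀ i, P.mark i = D.mark i) ∧
      (∃ S : Finset (ℂ × ℂ), (∀ p ∈ S, (p.1 - p.2).re = (p.1 - p.2).im ∨ (p.1 - p.2).re = -(p.1 - p.2).im) ∧
        frontier P.carrier ⊆ ⋃ p ∈ S, segment ℝ p.1 p.2) ∧
      ∀ s, dist (P.boundary s) (D.boundary s) ≤ ε := by
  classical
  set T : ℂ ≃ₜ ℂ := Homeomorph.mulLeft₀ (1 + Complex.I) one_add_I_ne_zero with hT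
  obtain ⟨P', hmark, ⟨S, hS, hcov⟩, hclose⟩ := exists_rectilinear_close (D.map T.symm) (half_pos hε)
  refine ⟨P'.map T, fun i => hmark i,
    ⟨S.image (fun e => ((1 + Complex.I) * e.1, (1 + Complex.I) * e.2)), ?_, ?_⟩, fun s => ?_⟩
  · intro e he
    obtain ⟨e₀, he₀, rfl⟩ := Finset.mem_image.1 he
    exact tilt_pair_diag (hS e₀ he₀)
  · rw [MarkedDomain.carrier_map, ← Homeomorph.image_frontier, ← image_tilt_biUnion_segment S]
    exact image_mono hcov
  · have h1 : (P'.map T).boundary s = (1 + Complex.I) * P'.boundary s := rfl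
    have h2 : D.boundary s = (1 + Complex.I) * (D.map T.symm).boundary s := by
      show D.boundary s = T (T.symm (D.boundary s))
      rw [Homeomorph.apply_symm_apply]
    rw [h1, h2]
    have := hclose s
    linarith [dist_tilt_le (P'.boundary s) ((D.map T.symm).boundary s)]

/-! ## §3 The diagonal sandwich: Cardy's formula for all-diagonal conformal rectangles gives `CardyFormulaZ2`

PIECE 2 of the stub, PROVED: the Bollobás–Riordan construction-free sandwich of the tree's
`RectilinearApproximation.cardyFormulaZ2_of_rectilinearCardy` (route `CardyBoundaryCoulombGas`, item
`RectilinearSuffices`, proved), re-run verbatim with the diagonal approximants of `exists_diag_close` in place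
of the rectilinear ones — the deterministic inclusions `discreteCrossing_subset_of_lower`,
`discreteCrossing_subset_plate` and the self-duality bound `bond_le_one_sub_real_openCrossing` only use that the
approximant has the marks of the comparison quad and a pointwise close boundary loop, never its shape. -/

/-- **Cardy's formula for bond-`ℤ²` in every conformal rectangle whose frontier lies in finitely many segments
of slope `±1` implies Cardy's formula in every conformal rectangle** (the diagonal twin of
`RectilinearSuffices_proof`). Fix `R` with datum `(φ, x)`, `L = F(η_R)`, `e > 0`. LOWER: Radó continuity
(`stub_cardyContinuity`) gives `ε₁`; the comparison geometry (`stub_comparisonGeometry`) gives a lower quad `Q`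
with room `r`; `exists_diag_close` gives a DIAGONAL `P` with the marks of `Q` and loop `min (ε₁/2) (r/2)`-close,
so `|F(η_P) - L| ≤ e/3` and `bond P δ ≤ bond R δ` for small `δ` (`discreteCrossing_subset_of_lower`, stub A
`stub_discreteCrossing_of_pathIn`); the hypothesis gives `bond P δ → F(η_P)`. UPPER: the same for the
cyclically re-marked copy (`stub_cyclicFlip`: `F = 1 - L`) and the upper quad `N`:
`bond R δ ≤ 1 - P[plate path of N] ≤ 1 - bond P' δ` (`bond_le_one_sub_real_openCrossing`, stub B
`stub_not_discreteCrossing_of_dualPathIn` + self-duality; `discreteCrossing_subset_plate`). -/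
theorem cardyFormulaZ2_of_diagCardy
    (hDC : ∀ R : ConformalRectangle, (∃ S : Finset (ℂ × ℂ), (∀ p ∈ S, (p.1 - p.2).re = (p.1 - p.2).im ∨
      (p.1 - p.2).re = -(p.1 - p.2).im) ∧ frontier R.carrier ⊆ ⋃ p ∈ S, segment ℝ p.1 p.2) →
      R.HasCrossingLimit (bondDomainCrossingProb R) Literature.Probability.RandomPlanarGeometry.cardyFunction) :
    Literature.Probability.Percolation.CardyFormulaZ2 := by
  -- adapted from RectilinearApproximation.cardyFormulaZ2_of_rectilinearCardy (diagonal approximants)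
  intro R φ x hux
  set L : ℝ := Literature.Probability.RandomPlanarGeometry.cardyFunction (crossRatio x) with hL
  -- the cyclically re-marked copy and the two continuity moduli
  obtain ⟨R₂, _hcar, hbd, hmk, hflip⟩ := stub_cyclicFlip R
  obtain ⟨φ₂, x₂, hux₂⟩ := MarkedDomain.exists_isUniformizing_holds R₂
  -- lower bound
  have hlow : ∀ e : ℝ, 0 < e → ∀ᶠ δ : ℝ in 𝓝[>] 0, L - e < bondDomainCrossingProb R δ := by
    intro e he
    obtain ⟨ε₁, hε₁, h1⟩ := stub_cardyContinuity R φ x hux (e / 3) (by positivity)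
    obtain ⟨m, hm, hgeo⟩ := stub_comparisonGeometry R (ε₁ / 2) (by positivity)
    obtain ⟨δ₀, hδ₀, t₀, ht₀, hAfor⟩ := stub_discreteCrossing_of_pathIn R
    obtain ⟨⟨Q, r, hr, hQb, hQm, hL1, hL2, hL3, hL4⟩, -⟩ := hgeo t₀ ht₀
    obtain ⟨P, hPmark, hPS, hPclose⟩ :=
      exists_diag_close Q (ε := min (ε₁ / 2) (r / 2)) (lt_min (by positivity) (by positivity))
    obtain ⟨ψ, y, hψ⟩ := MarkedDomain.exists_isUniformizing_holds P
    have hF : |Literature.Probability.RandomPlanarGeometry.cardyFunction (crossRatio y) - L| ≤ e / 3 := by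
      refine h1 P (fun u => ?_) (fun i => ?_) ψ y hψ
      · calc dist (P.boundary u) (R.boundary u)
            ≤ dist (P.boundary u) (Q.boundary u) + dist (Q.boundary u) (R.boundary u) := dist_triangle _ _ _
          _ ≤ min (ε₁ / 2) (r / 2) + ε₁ / 2 := add_le_add (hPclose u) (hQb u)
          _ ≤ ε₁ := by have := min_le_left (ε₁ / 2) (r / 2); linarith
      · rw [hPmark i]; exact (hQm i).trans (by linarith)
    have hPlim : Tendsto (bondDomainCrossingProb P) (𝓝[>] 0)
        (𝓝 (Literature.Probability.RandomPlanarGeometry.cardyFunction (crossRatio y))) :=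
      hDC P hPS ψ y hψ
    have hev1 : ∀ᶠ δ : ℝ in 𝓝[>] 0,
        Literature.Probability.RandomPlanarGeometry.cardyFunction (crossRatio y) - e / 3 <
          bondDomainCrossingProb P δ :=
      hPlim.eventually (lt_mem_nhds (by linarith))
    have hev2 : ∀ᶠ δ : ℝ in 𝓝[>] 0, δ ∈ Ioo 0 (min δ₀ (min m (r / 2))) :=
      Ioo_mem_nhdsGT (lt_min hδ₀ (lt_min hm (by positivity)))
    filter_upwards [hev1, hev2] with δ hδ1 hδ2
    have hδ₀' : δ < δ₀ := hδ2.2.trans_le (min_le_left _ _)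
    have hδm : δ < m := hδ2.2.trans_le ((min_le_right _ _).trans (min_le_left _ _))
    have hδr : δ < r / 2 := hδ2.2.trans_le ((min_le_right _ _).trans (min_le_right _ _))
    have hincl := discreteCrossing_subset_of_lower R Q P hAfor hL1 hL2 hL3 hL4 hPclose hPmark
      (le_min (by positivity) (by positivity)) (min_le_right _ _) hδ2.1 hδ₀' hδm hδr.le ht₀.le
    have hle : bondDomainCrossingProb P δ ≤ bondDomainCrossingProb R δ := by
      rw [bondDomainCrossingProb_eq_measureReal, bondDomainCrossingProb_eq_measureReal]
      exact measureReal_mono hincl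
    have hF' := (abs_sub_le_iff.1 hF).2
    linarith
  -- upper bound
  have hup : ∀ e : ℝ, 0 < e → ∀ᶠ δ : ℝ in 𝓝[>] 0, bondDomainCrossingProb R δ < L + e := by
    intro e he
    obtain ⟨ε₂, hε₂, h2⟩ := stub_cardyContinuity R₂ φ₂ x₂ hux₂ (e / 3) (by positivity)
    obtain ⟨m, hm, hgeo⟩ := stub_comparisonGeometry R (ε₂ / 2) (by positivity)
    obtain ⟨δ₀, hδ₀, t₀, ht₀, hBfor⟩ := stub_not_discreteCrossing_of_dualPathIn R m hm
    obtain ⟨-, ⟨N, r, hr, hNb, hNm, hU1, hU2, hU3, hU4, hU5⟩⟩ := hgeo t₀ ht₀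
    obtain ⟨P, hPmark, hPS, hPclose⟩ :=
      exists_diag_close N (ε := min (ε₂ / 2) (r / 4)) (lt_min (by positivity) (by positivity))
    obtain ⟨ψ, y, hψ⟩ := MarkedDomain.exists_isUniformizing_holds P
    have hF : |Literature.Probability.RandomPlanarGeometry.cardyFunction (crossRatio y) - (1 - L)| ≤ e / 3 := by
      rw [← hflip φ x φ₂ x₂ hux hux₂]
      refine h2 P (fun u => ?_) (fun i => ?_) ψ y hψ
      · rw [hbd u]
        calc dist (P.boundary u) (R.boundary (u + R.mark 1))
            ≤ dist (P.boundary u) (N.boundary u) + dist (N.boundary u) (R.boundary (u + R.mark 1)) :=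
              dist_triangle _ _ _
          _ ≤ min (ε₂ / 2) (r / 4) + ε₂ / 2 := add_le_add (hPclose u) (hNb u)
          _ ≤ ε₂ := by have := min_le_left (ε₂ / 2) (r / 4); linarith
      · rw [hPmark i, hmk i]; exact (hNm i).trans (by linarith)
    have hPlim : Tendsto (bondDomainCrossingProb P) (𝓝[>] 0)
        (𝓝 (Literature.Probability.RandomPlanarGeometry.cardyFunction (crossRatio y))) :=
      hDC P hPS ψ y hψ
    have hev1 : ∀ᶠ δ : ℝ in 𝓝[>] 0,
        Literature.Probability.RandomPlanarGeometry.cardyFunction (crossRatio y) - e / 3 <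
          bondDomainCrossingProb P δ :=
      hPlim.eventually (lt_mem_nhds (by linarith))
    have hev2 : ∀ᶠ δ : ℝ in 𝓝[>] 0, δ ∈ Ioo 0 (min δ₀ (min (m / 3) (r / 4))) :=
      Ioo_mem_nhdsGT (lt_min hδ₀ (lt_min (by positivity) (by positivity)))
    filter_upwards [hev1, hev2] with δ hδ1 hδ2
    have hδ₀' : δ < δ₀ := hδ2.2.trans_le (min_le_left _ _)
    have hδm : δ < m / 3 := hδ2.2.trans_le ((min_le_right _ _).trans (min_le_left _ _))
    have hδr : δ < r / 4 := hδ2.2.trans_le ((min_le_right _ _).trans (min_le_right _ _))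
    have hle := bond_le_one_sub_real_openCrossing R hBfor hU1 hU2 hU3 hU4 hU5 hδ2.1 hδ₀'
      (by linarith) (by linarith) ht₀.le le_rfl
    have hincl := discreteCrossing_subset_plate N P hPclose hPmark
      (le_min (by positivity) (by positivity)) (min_le_right _ _) hδ2.1 hδr.le
    have hle' : bondDomainCrossingProb P δ ≤ (bondPercolation (zdGraph 2) half).real
        (openCrossing {x : Site 2 | meshPoint δ x ∈ cthickening (r / 2) N.carrier}
          {x | meshPoint δ x ∈ cthickening (r / 2) (N.arc 0)}
          {x | meshPoint δ x ∈ cthickening (r / 2) (N.arc 2)}) := by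
      rw [bondDomainCrossingProb_eq_measureReal]
      exact measureReal_mono hincl
    have hF' := (abs_sub_le_iff.1 hF).2
    linarith
  rw [Metric.tendsto_nhds]
  intro e he
  filter_upwards [hlow e he, hup e he] with δ hδ1 hδ2
  rw [Real.dist_eq, abs_sub_lt_iff]
  constructor <;> linarith

/-- The converse is the restriction of the conjunct to all-diagonal conformal rectangles, so the diagonal
Cardy statement is EQUIVALENT to `CardyFormulaZ2` (the diagonal twin of
`rectilinearCardy_iff_cardyFormulaZ2`): PIECE 1 of the stub must prove the full conjunct's worth. -/
theorem diagCardy_iff_cardyFormulaZ2 :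
    (∀ R : ConformalRectangle, (∃ S : Finset (ℂ × ℂ), (∀ p ∈ S, (p.1 - p.2).re = (p.1 - p.2).im ∨ (p.1 - p.2).re = -(p.1 - p.2).im) ∧ frontier R.carrier ⊆ ⋃ p ∈ S, segment ℝ p.1 p.2) → R.HasCrossingLimit (bondDomainCrossingProb R) Literature.Probability.RandomPlanarGeometry.cardyFunction) ↔ Literature.Probability.Percolation.CardyFormulaZ2 :=
  ⟨cardyFormulaZ2_of_diagCardy, fun h R _ => h R⟩

/-! ## §4 The reduction of the stub to its two missing pieces (typed as hypotheses; nothing is asserted) -/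

/-- **`stub_allDomainsOfDiag` from its two missing pieces** (registered glue; kernel-checked composition, the
diagonal twin of `IicTraceFluxPairing.allDomainsOfRectilinear_of` with its middle piece now PROVED).
Hypotheses, both UNPROVED and of literature size:

* PIECE 1 — SLE₆ along every admissible family of every all-diagonal Dobrushin polygon ⇒ Cardy's crossing limit
  for every conformal rectangle whose frontier lies in finitely many segments of slope `±1` (covering form, as
  in `RectilinearCardy`). Content: crux 9654's line `collar-touch-sandwich` (`cardy_of_statements`: stubs A–G,
  all landed) run at ALL-DIAGONAL designer domains — it consumes SLE₆ only at the two collared Dobrushin domains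
  `Q₁.chord 0 1`, `Q₂.chord 0 3` of STUB E `CollarDomains`, whose collars are smooth arcs; needed is a collar
  construction with all-diagonal output for all-diagonal input (diagonal-staircase collars behind the sides;
  their plateau marks are smooth marks with `g = ±x`, allowed by `IsSmoothMark`), plus the passage from the
  covering form `frontier ⊆ ⋃ segments` to `IsDiagRectilinear` (`=`; a Jordan curve inside finitely many
  diagonal segments is a finite union of such segments).
* PIECE 3 — the Camia–Newman transfer on `ℤ²`: Cardy's formula for bond percolation in every conformal
  rectangle ⇒ identification of every subsequential interface law as chordal SLE₆, for every Jordan Dobrushin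
  domain and every admissible family (Camia–Newman 2007 Thms 2–4, §§5–7; Werner 2007 Lecture 3 §§3.4–3.8).
  No `def … : Prop` of the tree states it (searched `CamiaNewman`, `CardyToSLE6`, `CardyFormulaZ2 →`); on `ℤ²`
  the tree has RSW, tightness (`isTightAlongMesh_bondInterfaceIn`), measurability and the martingale
  identification of SLE_κ, but neither Cardy uniformly in the slit domains along the exploration nor the
  no-close-encounter lemmas (CN Lemmas 6.1–6.4, 7.1–7.4) for bond-`ℤ²`.

Glue: PIECE 1 ⇒ (`cardyFormulaZ2_of_diagCardy`, PIECE 2, PROVED above) `CardyFormulaZ2` ⇒ PIECE 3 ⇒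
(`slesixAllFamilies_of_identAllFamilies`, landed) block C. -/
theorem allDomainsOfDiag_of :
    ((∀ D : DobrushinDomain, IsDiagRectilinear D → ∀ Λ : ℝ → DiscreteDobrushin, IsFamily D Λ → SLESixAlong D Λ) → ∀ R : ConformalRectangle, (∃ S : Finset (ℂ × ℂ), (∀ p ∈ S, (p.1 - p.2).re = (p.1 - p.2).im ∨ (p.1 - p.2).re = -(p.1 - p.2).im) ∧ frontier R.carrier ⊆ ⋃ p ∈ S, segment ℝ p.1 p.2) → R.HasCrossingLimit (bondDomainCrossingProb R) Literature.Probability.RandomPlanarGeometry.cardyFunction) → (Literature.Probability.Percolation.CardyFormulaZ2 → ∀ (D : DobrushinDomain) (Λ : ℝ → DiscreteDobrushin), IsFamily D Λ → ∀ μ : Measure (CurveClass ℂ), IsProbabilityMeasure μ → IsSubseqLimitLaw (iface D Λ) perc μ → IsSLELaw 6 D μ) → (∀ D : DobrushinDomain, IsDiagRectilinear D → ∀ Λ : ℝ → DiscreteDobrushin, IsFamily D Λ → SLESixAlong D Λ) → SLESixAllFamilies := by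
  intro h₁ h₃ h
  exact slesixAllFamilies_of_identAllFamilies (h₃ (cardyFormulaZ2_of_diagCardy (h₁ h)))

/-- What PIECES 1 + 2 alone give (remark for the tenure planner, kernel-checked): SLE₆ along every admissible
family of every all-diagonal polygon already yields the ROUTE's target `CardyFormulaZ2` through PIECE 1 and the
proved diagonal sandwich; PIECE 3 (Camia–Newman on `ℤ²`) is forced only because block C asks for ALL domains. -/
theorem cardyFormulaZ2_of_diag_of :
    ((∀ D : DobrushinDomain, IsDiagRectilinear D → ∀ Λ : ℝ → DiscreteDobrushin, IsFamily D Λ → SLESixAlong D Λ) → ∀ R : ConformalRectangle, (∃ S : Finset (ℂ × ℂ), (∀ p ∈ S, (p.1 - p.2).re = (p.1 - p.2).im ∨ (p.1 - p.2).re = -(p.1 - p.2).im) ∧ frontier R.carrier ⊆ ⋃ p ∈ S, segment ℝ p.1 p.2) → R.HasCrossingLimit (bondDomainCrossingProb R) Literature.Probability.RandomPlanarGeometry.cardyFunction) → (∀ D : DobrushinDomain, IsDiagRectilinear D → ∀ Λ : ℝ → DiscreteDobrushin, IsFamily D Λ → SLESixAlong D Λ) → Literature.Probability.Percolation.CardyFormulaZ2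 :=
  fun h₁ h => cardyFormulaZ2_of_diagCardy (h₁ h)

end Summit.CriticalPhenomena.CardyFormulaZ2.Cruxes.ParafermionToSLESixFamilies.FlipInvolutionReturnLaw

end
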